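import Summits.QuantumFields.BalabanUV.Beta.EriceRemainderEnclosureHistoryAutonomyComparisonAgeCompositionWeightedVariation

/-!
# EriceRemainderEnclosureHistoryAutonomyComparisonAgeCompositionGeometricSocket — (E115i) route (N), first order, ABSTRACT: THE FIRST TERM THROUGH THE DEEP
# YOUNG FACTOR AND A GEOMETRICALLY WEIGHTED VARIATION — NO WINDOW COUNT TO CHOOSE.  For a light system of finite range (rows `≤ ρ ≤ 1` below the pin, lags `< k`,
# the END at every truncation) the indicator solutions at the pin hardly depend on a deep truncation: `|S 1_{[0,J]} n − S 1_{[0,J′]} n| ≤ ρ^D` when `J, J′ ≥ n + D·k`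
# (**`indicator_sol_diff_le`**, (E115b) locality).  With the Abel decomposition of (E115a) this gives, for EVERY zero-tailed input `f`,
#     `S f n ≥ S 1_{[0,N]} n · f n − Σ_{J≥n} |f J − f (J+1)|·ρ^{⌊(J−n)∕k⌋}`      (**`sol_ge_deep_floor_sub_geom_var`**; also `≤ … +`, **`abs_sol_sub_deep_floor_le`**):
# the solution at the pin is the DEEP young END value times the input AT the pin, up to the variation of the input weighted GEOMETRICALLY in the distance below the
# pin (one factor `ρ` per young window).  Against (E115a) `sol_ge_local` (floor `u`, increase over `D` windows at the full price `1−u`, far field `ρ^D·(f b + Var)`):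
# no `D` to optimise, decreases and increases of `f` near the pin both cost only their size, and the far variation is killed geometrically — the form in which the
# first term of the KEY-free composition is RELATIVE to the old surplus at the pin as soon as the old surplus varies per row by a small multiple of itself near the
# pin (README `HOME/b2b-balaban-beta-d4-p2/g96/README.md` §4 (H)(I), §6).  §3 composes it with (E115c): **`sol_ge_deep_first_sub_var`**.

Cell `pub-balaban`, β-function sub-cell, BINDER row D4 «RemainderConst leaves for Bałaban's split» (`HOME/BINDER-OWNERS.md`; owner lineage `b2b-balaban-beta-an4`;
this file by co-owner #2 lineage `b2b-balaban-beta-d4-p2`, generation 96), β-FLOW TEAM duty (1), FREEZE (0) honoured (def-free; imports (E115g); uses (E115a)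
`sol_eq_sum_Ico` ∕ `sum_Ico_steps` ∕ `sol_add`, (E115b) `abs_sol_le_pow_of_gap'`, (E115c) `sol_ge_first_sub_var` BY NAME; pure renewal algebra; nothing restated).

HONEST FRAMING (page 1, verbatim and binding).  *"Discharging BetaPertH makes Bałaban's UV stability UNCONDITIONAL — a real constructive-QFT result; it is
NOT the continuum limit and NOT the Clay problem."*  THIS FILE DISCHARGES NOTHING OF THE KIND.  Elementary linear algebra about ABSTRACT real sequences and
triangular systems — tools for the cell's own first-order census (route (N) of conjecture (E58′)); the form, signs, ages and moments of Bałaban's (1.22) limit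
functional are NOT PRINTED ([I] p. 298; GAPS G-t4-U2-1∕-2) and NOT asserted.  Row D4 class UNCHANGED (critical-path width 0; instance 0∕1; D4 DISCHARGE NO
DATE).  HONEST DEPENDENCY: continuum YM on T⁴ ⇐ BetaPertH ∧ nine spine estimates (0/9 proved); BetaPertH ⇐ (D1) ∧ (D4) ∧ CAP+tail; G-an2-4 gates asym, D1
and NE2/3/4.

NOT CLAIMED: any flow instance; anything printed — NOT B12 Thm 2, NOT BetaPertH, NOT continuum, NOT Clay.

WHAT IS PROVED ([folklore]; 0 `def`, 0 sorry; (E71a)'s conventions).  §1 **`indicator_sol_diff_le`**.  §2 **`sol_ge_deep_floor_sub_geom_var`**, **`abs_sol_sub_deep_floor_le`**.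
§3 **`sol_ge_deep_first_sub_var`**.
-/
noncomputable section
open Finset

namespace Summit.QuantumFields.BalabanUV.Beta.EriceRemainderEnclosureHistoryAutonomyComparisonAgeCompositionGeometricSocket

open Summit.QuantumFields.BalabanUV.Beta.EriceRemainderEnclosureHistoryAutonomyComparisonAgeComposition
open Summit.QuantumFields.BalabanUV.Beta.EriceRemainderEnclosureHistoryAutonomyComparisonAgeCompositionBVStability
open Summit.QuantumFields.BalabanUV.Beta.EriceRemainderEnclosureHistoryAutonomyComparisonAgeCompositionBVStabilityFlow (abs_sol_le_pow_of_gap')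
open Summit.QuantumFields.BalabanUV.Beta.EriceRemainderEnclosureHistoryAutonomyComparisonAgeCompositionKeyFree (sol_ge_first_sub_var)

variable {N : ℕ} {K KO Ky : ℕ → ℕ → ℝ} {R S RO Ry SO Sy : (ℕ → ℝ) → ℕ → ℝ}

/-! ## §1 Deep truncations hardly matter at the pin -/

/-- **DEEP TRUNCATIONS AGREE AT THE PIN.**  Light finite-range system (rows `≤ ρ ≤ 1` at the depths `≥ n`, lags `< k`, `k ≥ 1`) with indicator solutions in `[0,1]`:
for `n + D·k ≤ J ≤ J′ ≤ N`, `|S 1_{[0,J]} n − S 1_{[0,J′]} n| ≤ ρ^D` — the two inputs agree on the first `D` young windows below the pin. [folklore] -/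
theorem indicator_sol_diff_le (hR : ∀ v n, R v n = ∑ l ∈ range N, K n l * v (n + 1 + l))
    (hS : ∀ w : ℕ → ℝ, (∀ n, N < n → w n = 0) → (∀ n, N < n → S w n = 0) ∧ ∀ n, S w n = w n - R (S w) n)
    (hK : ∀ n l, 0 ≤ K n l) {n : ℕ} {ρ : ℝ} (hrow : ∀ m, n ≤ m → ∑ l ∈ range N, K m l ≤ ρ) (hρ1 : ρ ≤ 1)
    {k : ℕ} (hk : 1 ≤ k) (hKk : ∀ m l, k ≤ l → K m l = 0)
    (hEND : ∀ J m, J ≤ N → 0 ≤ S (fun m => if m ≤ J then (1 : ℝ) else 0) m ∧ S (fun m => if m ≤ J then (1 : ℝ) else 0) m ≤ 1)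
    {D J J' : ℕ} (hJ : n + D * k ≤ J) (hJJ' : J ≤ J') (hJ'N : J' ≤ N) :
    |S (fun m => if m ≤ J then (1 : ℝ) else 0) n - S (fun m => if m ≤ J' then (1 : ℝ) else 0) n| ≤ ρ ^ D := by
  have htJ : ∀ m, N < m → (fun m => if m ≤ J then (1 : ℝ) else 0) m = 0 := fun m hm => if_neg (show ¬ m ≤ J by omega)
  have htJ' : ∀ m, N < m → (fun m => if m ≤ J' then (1 : ℝ) else 0) m = 0 := fun m hm => if_neg (show ¬ m ≤ J' by omega)
  -- the difference of the inputs vanishes on [0, J] ⊇ [n, n + D k)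
  set w : ℕ → ℝ := fun m => (if m ≤ J then (1 : ℝ) else 0) + (-1) * (if m ≤ J' then (1 : ℝ) else 0) with hw
  have hneg_t : ∀ m, N < m → (fun m => (-1) * (if m ≤ J' then (1 : ℝ) else 0)) m = 0 := fun m hm => by
    show (-1) * (if m ≤ J' then (1 : ℝ) else 0) = 0; rw [if_neg (show ¬ m ≤ J' by omega), mul_zero]
  have hwt : ∀ m, N < m → w m = 0 := fun m hm => by simp only [hw, htJ m hm, hneg_t m hm, add_zero]
  -- S w = S 1_J − S 1_J'
  have hneg : ∀ m, S (fun m => (-1) * (if m ≤ J' then (1 : ℝ) else 0)) m = (-1) * S (fun m => if m ≤ J' then (1 : ℝ) else 0) m := by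
    have hut : ∀ m, N < m → (fun m => (-1) * S (fun m => if m ≤ J' then (1 : ℝ) else 0) m) m = 0 := fun m hm => by
      simp only [(hS _ htJ').1 m hm, mul_zero]
    have hurec : ∀ m, (fun m => (-1) * S (fun m => if m ≤ J' then (1 : ℝ) else 0) m) m
        = (fun m => (-1) * (if m ≤ J' then (1 : ℝ) else 0)) m - R (fun m => (-1) * S (fun m => if m ≤ J' then (1 : ℝ) else 0) m) m := fun m => by
      simp only [read_smul hR]; have := (hS _ htJ').2 m; linarith
    exact fun m => sol_unique hR (hS _ hneg_t).1 (hS _ hneg_t).2 hut hurec m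
  have hSw : ∀ m, S w m = S (fun m => if m ≤ J then (1 : ℝ) else 0) m - S (fun m => if m ≤ J' then (1 : ℝ) else 0) m := fun m => by
    rw [hw, sol_add hR hS htJ hneg_t m, hneg m]; ring
  -- |S w| ≤ 1 below J+1, and w = 0 on [n, J+1)
  have hM : ∀ m, J + 1 ≤ m → |S w m| ≤ 1 := fun m _ => by
    rw [hSw m, abs_le]
    obtain ⟨a0, a1⟩ := hEND J m (by omega); obtain ⟨b0, b1⟩ := hEND J' m hJ'N
    constructor <;> linarith
  have hw0 : ∀ m, n ≤ m → m < J + 1 → w m = 0 := fun m _ hm => by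
    simp only [hw]; rw [if_pos (by omega), if_pos (by omega)]; ring
  have h := abs_sol_le_pow_of_gap' hR hK hrow hρ1 hk hKk hw0 (hS w hwt).2 hM D n le_rfl (by omega)
  rw [hSw n, mul_one] at h
  exact h

/-! ## §2 The solution at the pin: deep young factor times the input at the pin, up to a geometrically weighted variation -/

/-- **THE GEOMETRIC SOCKET.**  Light finite-range system with the END at every truncation, rows `≤ ρ ≤ 1` below the pin `n`, lags `< k`; `f` zero-tailed.  Then
`S f n ≥ S 1_{[0,N]} n · f n − Σ_{n≤J≤N} |f J − f (J+1)|·ρ^{(J−n)∕k}` (natural-number division in the exponent). [folklore] -/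
theorem sol_ge_deep_floor_sub_geom_var (hR : ∀ v n, R v n = ∑ l ∈ range N, K n l * v (n + 1 + l))
    (hS : ∀ w : ℕ → ℝ, (∀ n, N < n → w n = 0) → (∀ n, N < n → S w n = 0) ∧ ∀ n, S w n = w n - R (S w) n)
    (hK : ∀ n l, 0 ≤ K n l) {n : ℕ} {ρ : ℝ} (hrow : ∀ m, n ≤ m → ∑ l ∈ range N, K m l ≤ ρ) (hρ1 : ρ ≤ 1)
    {k : ℕ} (hk : 1 ≤ k) (hKk : ∀ m l, k ≤ l → K m l = 0)
    (hEND : ∀ J m, J ≤ N → 0 ≤ S (fun m => if m ≤ J then (1 : ℝ) else 0) m ∧ S (fun m => if m ≤ J then (1 : ℝ) else 0) m ≤ 1)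
    {f : ℕ → ℝ} (hf : ∀ m, N < m → f m = 0) :
    S (fun m => if m ≤ N then (1 : ℝ) else 0) n * f n - ∑ J ∈ Ico n (N + 1), |f J - f (J + 1)| * ρ ^ ((J - n) / k) ≤ S f n := by
  by_cases hn : n ≤ N + 1
  · rw [sol_eq_sum_Ico hR hS hf hn]
    -- Σ_J Δf_J S1_J(n) = S1_N(n)·Σ_J Δf_J + Σ_J Δf_J (S1_J(n) − S1_N(n))
    have hsplit : ∑ J ∈ Ico n (N + 1), (f J - f (J + 1)) * S (fun m => if m ≤ J then (1 : ℝ) else 0) n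
        = S (fun m => if m ≤ N then (1 : ℝ) else 0) n * f n
          + ∑ J ∈ Ico n (N + 1), (f J - f (J + 1)) * (S (fun m => if m ≤ J then (1 : ℝ) else 0) n - S (fun m => if m ≤ N then (1 : ℝ) else 0) n) := by
      rw [← sum_Ico_steps hf hn, mul_sum, ← sum_add_distrib]
      exact sum_congr rfl fun J _ => by ring
    rw [hsplit]
    have hterm : ∀ J ∈ Ico n (N + 1), -(|f J - f (J + 1)| * ρ ^ ((J - n) / k))
        ≤ (f J - f (J + 1)) * (S (fun m => if m ≤ J then (1 : ℝ) else 0) n - S (fun m => if m ≤ N then (1 : ℝ) else 0) n) := by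
      intro J hJ
      have hJ' := mem_Ico.mp hJ
      have hd := indicator_sol_diff_le hR hS hK hrow hρ1 hk hKk hEND (D := (J - n) / k) (J := J) (J' := N)
        (by have := Nat.div_mul_le_self (J - n) k; omega) (by omega) le_rfl
      have := neg_abs_le ((f J - f (J + 1)) * (S (fun m => if m ≤ J then (1 : ℝ) else 0) n - S (fun m => if m ≤ N then (1 : ℝ) else 0) n))
      rw [abs_mul] at this
      nlinarith [abs_nonneg (f J - f (J + 1)), abs_nonneg (S (fun m => if m ≤ J then (1 : ℝ) else 0) n - S (fun m => if m ≤ N then (1 : ℝ) else 0) n)]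
    have hs := sum_le_sum hterm
    rw [sum_neg_distrib] at hs
    linarith
  · rw [(hS f hf).1 n (by omega), hf n (by omega), mul_zero, Ico_eq_empty (by omega), sum_empty, sub_zero]

/-- **THE GEOMETRIC SOCKET, TWO-SIDED.**  `|S f n − S 1_{[0,N]} n · f n| ≤ Σ_{n≤J≤N} |f J − f (J+1)|·ρ^{(J−n)∕k}`. [folklore] -/
theorem abs_sol_sub_deep_floor_le (hR : ∀ v n, R v n = ∑ l ∈ range N, K n l * v (n + 1 + l))
    (hS : ∀ w : ℕ → ℝ, (∀ n, N < n → w n = 0) → (∀ n, N < n → S w n = 0) ∧ ∀ n, S w n = w n - R (S w) n)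
    (hK : ∀ n l, 0 ≤ K n l) {n : ℕ} {ρ : ℝ} (hrow : ∀ m, n ≤ m → ∑ l ∈ range N, K m l ≤ ρ) (hρ1 : ρ ≤ 1)
    {k : ℕ} (hk : 1 ≤ k) (hKk : ∀ m l, k ≤ l → K m l = 0)
    (hEND : ∀ J m, J ≤ N → 0 ≤ S (fun m => if m ≤ J then (1 : ℝ) else 0) m ∧ S (fun m => if m ≤ J then (1 : ℝ) else 0) m ≤ 1)
    {f : ℕ → ℝ} (hf : ∀ m, N < m → f m = 0) :
    |S f n - S (fun m => if m ≤ N then (1 : ℝ) else 0) n * f n| ≤ ∑ J ∈ Ico n (N + 1), |f J - f (J + 1)| * ρ ^ ((J - n) / k) := by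
  have h1 := sol_ge_deep_floor_sub_geom_var hR hS hK hrow hρ1 hk hKk hEND hf
  -- the same with −f
  have hnf : ∀ m, N < m → (fun m => (-1) * f m) m = 0 := fun m hm => by simp only [hf m hm, mul_zero]
  have h2 := sol_ge_deep_floor_sub_geom_var hR hS hK hrow hρ1 hk hKk hEND hnf (n := n)
  have hneg : S (fun m => (-1) * f m) n = (-1) * S f n := by
    have hut : ∀ m, N < m → (fun m => (-1) * S f m) m = 0 := fun m hm => by simp only [(hS f hf).1 m hm, mul_zero]
    have hurec : ∀ m, (fun m => (-1) * S f m) m = (fun m => (-1) * f m) m - R (fun m => (-1) * S f m) m := fun m => by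
      simp only [read_smul hR]; have := (hS f hf).2 m; linarith
    exact sol_unique hR (hS _ hnf).1 (hS _ hnf).2 hut hurec n
  have habs : ∀ J, |(-1) * f J - (-1) * f (J + 1)| = |f J - f (J + 1)| := fun J => by
    rw [show (-1) * f J - (-1) * f (J + 1) = -(f J - f (J + 1)) by ring, abs_neg]
  simp only [hneg, habs] at h2
  rw [abs_le]; constructor <;> linarith

/-! ## §3 Composition: the full surplus through the deep young factor -/

/-- **THE KEY-FREE COMPOSITION BOUND, GEOMETRIC FORM.**  Old kernel with the END at every truncation; young kernel `≥ 0` with rows `≤ ρ < 1` below the pin, lags `< k`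
(`k ≥ 1`), the END at every truncation; `ε` the zero-tailed full surplus of the zero-tailed excess `e`; `v = S_O e`; `g = R_O (R_y ε)`.  Then
`ε n ≥ S_y 1_{[0,N]} n · v n − Σ_{J≥n} |v J − v (J+1)|·ρ^{(J−n)∕k} − Var_{≥n} g ∕ (1−ρ)`. [folklore] -/
theorem sol_ge_deep_first_sub_var
    (hRO : ∀ v n, RO v n = ∑ l ∈ range N, KO n l * v (n + 1 + l))
    (hRy : ∀ v n, Ry v n = ∑ l ∈ range N, Ky n l * v (n + 1 + l)) (hKy : ∀ n l, 0 ≤ Ky n l)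
    (hSO : ∀ w : ℕ → ℝ, (∀ n, N < n → w n = 0) → (∀ n, N < n → SO w n = 0) ∧ ∀ n, SO w n = w n - RO (SO w) n)
    (hSy : ∀ w : ℕ → ℝ, (∀ n, N < n → w n = 0) → (∀ n, N < n → Sy w n = 0) ∧ ∀ n, Sy w n = w n - Ry (Sy w) n)
    (hENDO : ∀ J n, J ≤ N → 0 ≤ SO (fun m => if m ≤ J then (1 : ℝ) else 0) n ∧ SO (fun m => if m ≤ J then (1 : ℝ) else 0) n ≤ 1)
    (hENDy : ∀ J n, J ≤ N → 0 ≤ Sy (fun m => if m ≤ J then (1 : ℝ) else 0) n ∧ Sy (fun m => if m ≤ J then (1 : ℝ) else 0) n ≤ 1)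
    {n : ℕ} {ρ : ℝ} (hrow : ∀ m, n ≤ m → ∑ l ∈ range N, Ky m l ≤ ρ) (hρ1 : ρ < 1)
    {k : ℕ} (hk : 1 ≤ k) (hKyk : ∀ m l, k ≤ l → Ky m l = 0)
    {e : ℕ → ℝ} (he : ∀ n, N < n → e n = 0)
    {ε : ℕ → ℝ} (hεtail : ∀ n, N < n → ε n = 0) (hεrec : ∀ n, ε n = e n - RO ε n - Ry ε n) :
    Sy (fun m => if m ≤ N then (1 : ℝ) else 0) n * SO e n - ∑ J ∈ Ico n (N + 1), |SO e J - SO e (J + 1)| * ρ ^ ((J - n) / k)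
      - (∑ J ∈ Ico n (N + 1), |RO (Ry ε) J - RO (Ry ε) (J + 1)|) / (1 - ρ) ≤ ε n := by
  have h1 := sol_ge_first_sub_var hRO hRy hKy hSO hSy hENDO hrow hρ1 he hεtail hεrec
  have h2 := sol_ge_deep_floor_sub_geom_var hRy hSy hKy hrow hρ1.le hk hKyk hENDy (hSO e he).1 (n := n)
  linarith

end Summit.QuantumFields.BalabanUV.Beta.EriceRemainderEnclosureHistoryAutonomyComparisonAgeCompositionGeometricSocket

end
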